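import Summits.AtomisticToContinuum.BoseEinsteinCondensation.Theorems.InfraredMinimumUncertainty.Negative.CellShiftToolkit
import Summits.AtomisticToContinuum.BoseEinsteinCondensation.Theorems.GaussianDominationCan.Negative.ProductStatesConst
import Summits.AtomisticToContinuum.BoseEinsteinCondensation.Theorems.BECConjugateDominationDefs

/-!
# Negative lemmas for crux `InfraredMinimumUncertainty` (stmt-AtomisticToContinuum-11784) — II:
# the free density wave `(c(1 + 2ε cos θ_{e₀}))^{⊗N}`, its coherence and its Lévy weight

Supports (does not close) stmt-AtomisticToContinuum-11784 (route `BECConjugateDomination`).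
Importable form of §W (first half) of `Cruxes/InfraredMinimumUncertainty/Disproof.lean`
(generation 1).  Over the landed vocabulary `coherence` / `levyWeight` of
`Theorems/BECConjugateDominationDefs.lean` (the crux's `let g`, `let ν` verbatim):

* `cnorm`, `waveFactor` (`φ = c(1 + 2ε cos θ_{e₀})`, `∫_cell φ² = 1`), `waveFactorC`, `waveFun`,
  `waveState n hL ε = φ^{⊗N}` (an admissible periodic Bose trial state; positive and real for
  `|ε| < 1/2`: `waveFun_eq_norm`, `waveFun_ne_zero`); `integral_cell_cos_mul_waveFactor_sq`
  (`∫ cos θ φ² = 2ε/(1+2ε²)`), `integral_cell_waveFactor_shift_mul`, `hasFDerivAt_waveFactorC`,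
  `sum_nnnorm_sq_fderiv_waveFactorC_le` (`|∇φ|² ≤ 16π²ε²c²/L²`);
* `coherence_waveState`: **`g(r) = (1 + 2ε² cos θ_{e₀}(r)) / (1 + 2ε²)` in closed form**;
* `levyWeight_waveState_ge`: **`ν_{e₀} ≥ ε²(1 − 2ε²)`** (the phase weight of a density wave is
  `O(ε²) > 0`, independent of `N`).
-/

noncomputable section

open MeasureTheory Filter Set
open scoped ENNReal NNReal Topology ComplexConjugate BigOperators

namespace Summit.AtomisticToContinuum.BoseEinsteinCondensation.Theorems.InfraredMinimumUncertainty.Negative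

open Literature.MathematicalPhysics.QuantumManyBody.BoseGas
open Summit.AtomisticToContinuum.BoseEinsteinCondensation.Theses.BECConjugateDomination
open Summit.AtomisticToContinuum.BoseEinsteinCondensation.Cruxes.InfraredMinimumUncertainty.FisherGaussianDensityMode
open Summit.AtomisticToContinuum.BoseEinsteinCondensation.Theorems.GaussianDominationCan.Negative
  (prodFun contDiff_prodFun continuous_prodFun prodFun_periodic prodFun_const_symm nnnorm_sq_prodFun
    lintegral_nnnorm_sq_prodFun fderiv_prodFun kineticDensity_prodFun lintegral_prod_erase
    periodicInteraction_zero lintegral_cellN_prod lintegral_cell_const volume_real_cell)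
open Summit.AtomisticToContinuum.BoseEinsteinCondensation.Theorems.StaticResponseBound.Negative
  (arg arg_intSMul re_cellWave integral_cell_cos_arg integral_cell_const phiMode continuous_arg
    contDiff_arg continuous_phiMode contDiff_phiMode arg_add_single phiMode_periodic phiMode_pos
    integral_cell_trig_combo integral_cell_phiMode_sq integral_cell_cos_mul_phiMode_sq
    isFiniteMeasure_restrict_cell argCLM argCLM_apply argCLM_single hasFDerivAt_phiMode
    isRepulsiveFiniteRange_zero integral_norm_sq_eq_one)
open Summit.AtomisticToContinuum.BoseEinsteinCondensation.Theorems.CorrectorClosure.Negative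
  (e0 e0_ne_zero sideLength_succ_pos)

/-! ## §W  The free density wave `(c(1 + 2ε cos θ_{e₀}))^{⊗N}` and its `g`, `ν`, `S`, `E` -/

section Wave

variable {L : ℝ} {ε : ℝ} {n : ℕ}

/-- The normalisation `c = ((1 + 2ε²)L³)^{-1/2}`. -/
def cnorm (L ε : ℝ) : ℝ := (Real.sqrt ((1 + 2 * ε ^ 2) * L ^ 3))⁻¹

/-- `(1 + 2ε²)L³ > 0`. [folklore] -/
theorem normArg_pos (hL : 0 < L) (ε : ℝ) : 0 < (1 + 2 * ε ^ 2) * L ^ 3 := by positivity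

/-- `c > 0`. [folklore] -/
theorem cnorm_pos (hL : 0 < L) (ε : ℝ) : 0 < cnorm L ε := by
  unfold cnorm
  exact inv_pos.mpr (Real.sqrt_pos.mpr (normArg_pos hL ε))

/-- `c² (1 + 2ε²) L³ = 1`. [folklore] -/
theorem cnorm_sq_mul (hL : 0 < L) (ε : ℝ) : cnorm L ε ^ 2 * ((1 + 2 * ε ^ 2) * L ^ 3) = 1 := by
  unfold cnorm
  rw [inv_pow, Real.sq_sqrt (normArg_pos hL ε).le, inv_mul_cancel₀ (normArg_pos hL ε).ne']

/-- `c² L³ = 1/(1 + 2ε²)`. [folklore] -/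
theorem cnorm_sq_mul_cube (hL : 0 < L) (ε : ℝ) : cnorm L ε ^ 2 * L ^ 3 = (1 + 2 * ε ^ 2)⁻¹ := by
  have h := cnorm_sq_mul hL ε
  have h1 : (0 : ℝ) < 1 + 2 * ε ^ 2 := by positivity
  field_simp
  linarith [h]

/-- `c² L³ ≤ 1`. [folklore] -/
theorem cnorm_sq_mul_cube_le_one (hL : 0 < L) (ε : ℝ) : cnorm L ε ^ 2 * L ^ 3 ≤ 1 := by
  rw [cnorm_sq_mul_cube hL]
  exact inv_le_one_of_one_le₀ (by nlinarith [sq_nonneg ε])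

/-- `|e₀|² = 1`. [folklore] -/
theorem sum_sq_e0 : ∑ j : Fin 3, ((e0 j : ℤ) : ℝ) ^ 2 = 1 := by
  simp [e0, Pi.single_apply]

/-- The real one-body factor `φ = c (1 + 2ε cos θ_{e₀})`. -/
def waveFactor (L ε : ℝ) (x : Space) : ℝ := cnorm L ε * phiMode L e0 ε x

/-- The one-body factor as a complex function. -/
def waveFactorC (L ε : ℝ) (x : Space) : ℂ := (waveFactor L ε x : ℂ)

/-- `φ > 0` for `|ε| < 1/2`. [folklore] -/
theorem waveFactor_pos (hL : 0 < L) (hε : |ε| < 1 / 2) (x : Space) : 0 < waveFactor L ε x :=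
  mul_pos (cnorm_pos hL ε) (phiMode_pos hε x)

/-- `φ` is continuous. [folklore] -/
@[fun_prop]
theorem continuous_waveFactor (L ε : ℝ) : Continuous (waveFactor L ε) := by
  unfold waveFactor; fun_prop

/-- `φ` is `C¹`. [folklore] -/
theorem contDiff_waveFactor (L ε : ℝ) : ContDiff ℝ 1 (waveFactor L ε) := by
  unfold waveFactor
  exact contDiff_const.mul (contDiff_phiMode L e0 ε)

/-- `φ` (complex) is continuous. [folklore] -/
@[fun_prop]
theorem continuous_waveFactorC (L ε : ℝ) : Continuous (waveFactorC L ε) := by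
  unfold waveFactorC; fun_prop

/-- `φ` (complex) is `C¹`. [folklore] -/
theorem contDiff_waveFactorC (L ε : ℝ) : ContDiff ℝ 1 (waveFactorC L ε) :=
  Complex.ofRealCLM.contDiff.comp (contDiff_waveFactor L ε)

/-- `φ` is `Lℤ³`-periodic. [folklore] -/
theorem waveFactorC_periodic (hL : L ≠ 0) (ε : ℝ) (x : Space) (a : Fin 3) :
    waveFactorC L ε (x + EuclideanSpace.single a L) = waveFactorC L ε x := by
  simp [waveFactorC, waveFactor, phiMode_periodic hL]

/-- `‖φ_ℂ‖ = φ` (`φ > 0`). [folklore] -/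
theorem norm_waveFactorC (hL : 0 < L) (hε : |ε| < 1 / 2) (x : Space) :
    ‖waveFactorC L ε x‖ = waveFactor L ε x := by
  rw [waveFactorC, Complex.norm_real, Real.norm_of_nonneg (waveFactor_pos hL hε x).le]

/-- `∫_cell φ² = 1`. [folklore] -/
theorem integral_cell_waveFactor_sq (hL : 0 < L) (ε : ℝ) :
    ∫ x in cell L, waveFactor L ε x ^ 2 = 1 := by
  unfold waveFactor
  simp_rw [mul_pow]
  rw [integral_const_mul, integral_cell_phiMode_sq hL e0_ne_zero, cnorm_sq_mul hL]

/-- `∫⁻_cell ‖φ_ℂ‖₊² = 1`. [folklore] -/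
theorem lintegral_nnnorm_sq_waveFactorC (hL : 0 < L) (ε : ℝ) :
    ∫⁻ x in cell L, (‖waveFactorC L ε x‖₊ : ℝ≥0∞) ^ 2 = 1 := by
  simp_rw [coe_nnnorm_sq_eq_ofReal]
  rw [← ofReal_integral_eq_lintegral_ofReal (integrableOn_sq_cell L (continuous_waveFactorC L ε))
    (Eventually.of_forall fun x => by positivity)]
  have : ∀ x, ‖waveFactorC L ε x‖ ^ 2 = waveFactor L ε x ^ 2 := fun x => by
    rw [waveFactorC, Complex.norm_real, Real.norm_eq_abs, sq_abs]
  simp_rw [this]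
  rw [integral_cell_waveFactor_sq hL, ENNReal.ofReal_one]

/-- `∫_cell cos θ_{e₀} φ² = 2ε/(1 + 2ε²)` — the density modulation of `φ²`. [folklore] -/
theorem integral_cell_cos_mul_waveFactor_sq (hL : 0 < L) (ε : ℝ) :
    ∫ x in cell L, Real.cos (arg L e0 x) * waveFactor L ε x ^ 2 = 2 * ε / (1 + 2 * ε ^ 2) := by
  unfold waveFactor
  have : ∀ x, Real.cos (arg L e0 x) * (cnorm L ε * phiMode L e0 ε x) ^ 2 =
      cnorm L ε ^ 2 * (Real.cos (arg L e0 x) * phiMode L e0 ε x ^ 2) := fun x => by ring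
  simp_rw [this]
  rw [integral_const_mul, integral_cell_cos_mul_phiMode_sq hL e0_ne_zero,
    show cnorm L ε ^ 2 * (2 * ε * L ^ 3) = 2 * ε * (cnorm L ε ^ 2 * L ^ 3) by ring,
    cnorm_sq_mul_cube hL, div_eq_mul_inv]

/-- `∫_cell φ(x + r) φ(x) dx = (1 + 2ε² cos θ_{e₀}(r))/(1 + 2ε²)`. [folklore] -/
theorem integral_cell_waveFactor_shift_mul (hL : 0 < L) (ε : ℝ) (r : Space) :
    ∫ x in cell L, waveFactor L ε (x + r) * waveFactor L ε x =
      (1 + 2 * ε ^ 2 * Real.cos (arg L e0 r)) / (1 + 2 * ε ^ 2) := by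
  unfold waveFactor
  have : ∀ x, cnorm L ε * phiMode L e0 ε (x + r) * (cnorm L ε * phiMode L e0 ε x) =
      cnorm L ε ^ 2 * (phiMode L e0 ε (x + r) * phiMode L e0 ε x) := fun x => by ring
  simp_rw [this]
  rw [integral_const_mul, integral_cell_phiMode_shift_mul hL e0_ne_zero,
    show cnorm L ε ^ 2 * ((1 + 2 * ε ^ 2 * Real.cos (arg L e0 r)) * L ^ 3) =
      (1 + 2 * ε ^ 2 * Real.cos (arg L e0 r)) * (cnorm L ε ^ 2 * L ^ 3) by ring,
    cnorm_sq_mul_cube hL, div_eq_mul_inv]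

/-- The derivative of `φ_ℂ`: `dφ_ℂ(x) = ofReal ∘ (c · (−2ε sin θ(x)) · θ)`. [folklore] -/
theorem hasFDerivAt_waveFactorC (L ε : ℝ) (x : Space) :
    HasFDerivAt (waveFactorC L ε)
      (Complex.ofRealCLM.comp ((cnorm L ε * (2 * ε * -Real.sin (arg L e0 x))) • argCLM L e0)) x := by
  have h1 := (hasFDerivAt_phiMode L e0 ε x).const_mul (cnorm L ε)
  rw [smul_smul] at h1
  exact Complex.ofRealCLM.hasFDerivAt.comp x h1

/-- `∑ⱼ ‖∂ⱼφ_ℂ(x)‖₊² ≤ 16π²ε²c²/L²` (since `|sin| ≤ 1` and `|e₀| = 1`). [folklore] -/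
theorem sum_nnnorm_sq_fderiv_waveFactorC_le (hL : 0 < L) (ε : ℝ) (x : Space) :
    ∑ j : Fin 3, ((‖fderiv ℝ (waveFactorC L ε) x (EuclideanSpace.single j 1)‖₊ : ℝ≥0∞) ^ 2) ≤
      ENNReal.ofReal (cnorm L ε ^ 2 * (16 * Real.pi ^ 2 * ε ^ 2 / L ^ 2)) := by
  rw [(hasFDerivAt_waveFactorC L ε x).fderiv]
  have hval : ∀ j : Fin 3,
      (Complex.ofRealCLM.comp ((cnorm L ε * (2 * ε * -Real.sin (arg L e0 x))) • argCLM L e0))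
        (EuclideanSpace.single j 1) =
        ((cnorm L ε * (2 * ε * -Real.sin (arg L e0 x)) * (2 * Real.pi / L * (e0 j : ℝ)) : ℝ) : ℂ) := by
    intro j
    simp [argCLM_single]
  simp_rw [hval, coe_nnnorm_sq_eq_ofReal, Complex.norm_real, Real.norm_eq_abs, sq_abs]
  rw [← ENNReal.ofReal_sum_of_nonneg (fun j _ => sq_nonneg _)]
  refine ENNReal.ofReal_le_ofReal ?_
  have hs : Real.sin (arg L e0 x) ^ 2 ≤ 1 := Real.sin_sq_le_one _
  set A : ℝ := cnorm L ε * (2 * ε * -Real.sin (arg L e0 x)) with hAdef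
  have hsum : ∑ j : Fin 3, (A * (2 * Real.pi / L * (e0 j : ℝ))) ^ 2 = A ^ 2 * (2 * Real.pi / L) ^ 2 := by
    have : ∀ j : Fin 3, (A * (2 * Real.pi / L * (e0 j : ℝ))) ^ 2 =
        A ^ 2 * (2 * Real.pi / L) ^ 2 * ((e0 j : ℤ) : ℝ) ^ 2 := fun j => by ring
    simp_rw [this, ← Finset.mul_sum, sum_sq_e0, mul_one]
  have hA : A ^ 2 * (2 * Real.pi / L) ^ 2 =
      cnorm L ε ^ 2 * (16 * Real.pi ^ 2 * ε ^ 2 / L ^ 2) * Real.sin (arg L e0 x) ^ 2 := by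
    have hL0 : L ≠ 0 := hL.ne'
    rw [hAdef]
    field_simp
    ring
  rw [hsum, hA]
  have h0 : 0 ≤ cnorm L ε ^ 2 * (16 * Real.pi ^ 2 * ε ^ 2 / L ^ 2) := by positivity
  calc cnorm L ε ^ 2 * (16 * Real.pi ^ 2 * ε ^ 2 / L ^ 2) * Real.sin (arg L e0 x) ^ 2
      ≤ cnorm L ε ^ 2 * (16 * Real.pi ^ 2 * ε ^ 2 / L ^ 2) * 1 := mul_le_mul_of_nonneg_left hs h0
    _ = _ := mul_one _

/-- `φ^{⊗N}` (complex). -/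
def waveFun (n : ℕ) (L ε : ℝ) : Config (n + 1) → ℂ :=
  prodFun (fun _ : Fin (n + 1) => waveFactorC L ε)

/-- **The free density wave** `Ψ = (c(1 + 2ε cos θ_{e₀}))^{⊗N}` as an admissible periodic Bose
trial state (`|ε| < 1/2`; every factor has `∫_cell φ² = 1`). -/
def waveState (n : ℕ) (hL : 0 < L) (ε : ℝ) : PeriodicTrialState (n + 1) L where
  ψ := waveFun n L ε
  contDiff := contDiff_prodFun fun _ => contDiff_waveFactorC L ε
  periodic X i a := prodFun_periodic (fun _ x a => waveFactorC_periodic hL.ne' ε x a) X i a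
  symm σ X := prodFun_const_symm _ σ X
  norm_eq := by
    show ∫⁻ X in cellN (n + 1) L,
      (‖prodFun (fun _ : Fin (n + 1) => waveFactorC L ε) X‖₊ : ℝ≥0∞) ^ 2 = 1
    rw [lintegral_nnnorm_sq_prodFun (fun _ => continuous_waveFactorC L ε)]
    simp only [lintegral_nnnorm_sq_waveFactorC hL, Finset.prod_const_one]

/-- The wave function of `waveState` is the product. [folklore] -/
@[simp] theorem waveState_ψ (hL : 0 < L) (ε : ℝ) :
    (waveState n hL ε).ψ = waveFun n L ε := rfl

/-- `‖Ψ(X)‖ = ∏ᵢ φ(xᵢ)`. [folklore] -/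
theorem norm_waveFun (hL : 0 < L) (hε : |ε| < 1 / 2) (X : Config (n + 1)) :
    ‖waveFun n L ε X‖ = ∏ i, waveFactor L ε (X i) := by
  unfold waveFun prodFun
  rw [norm_prod]
  exact Finset.prod_congr rfl fun i _ => norm_waveFactorC hL hε (X i)

/-- `Ψ(X) = ‖Ψ(X)‖` (real non-negative). [folklore] -/
theorem waveFun_eq_norm (hL : 0 < L) (hε : |ε| < 1 / 2) (X : Config (n + 1)) :
    waveFun n L ε X = (‖waveFun n L ε X‖ : ℂ) := by
  rw [norm_waveFun hL hε, Complex.ofReal_prod]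
  rfl

/-- `Ψ(X) ≠ 0`. [folklore] -/
theorem waveFun_ne_zero (hL : 0 < L) (hε : |ε| < 1 / 2) (X : Config (n + 1)) :
    waveFun n L ε X ≠ 0 := by
  rw [waveFun_eq_norm hL hε, norm_waveFun hL hε, Complex.ofReal_ne_zero]
  exact (Finset.prod_pos fun i _ => waveFactor_pos hL hε (X i)).ne'

/-- `‖Ψ(x, Y)‖ = φ(x) ∏ᵢ φ(yᵢ)` (splitting off particle `0`). [folklore] -/
theorem norm_waveFun_vecCons (hL : 0 < L) (hε : |ε| < 1 / 2) (x : Space) (Y : Config n) :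
    ‖waveFun n L ε (Matrix.vecCons x Y)‖ = waveFactor L ε x * ∏ i, waveFactor L ε (Y i) := by
  rw [norm_waveFun hL hε, Fin.prod_univ_succ]
  simp

/-- `‖Ψ(X)‖² = ∏ᵢ φ(xᵢ)²`. [folklore] -/
theorem norm_sq_waveFun (hL : 0 < L) (hε : |ε| < 1 / 2) (X : Config (n + 1)) :
    ‖waveFun n L ε X‖ ^ 2 = ∏ i, waveFactor L ε (X i) ^ 2 := by
  rw [norm_waveFun hL hε, Finset.prod_pow]

/-- **The coherence of the density wave, in closed form**:
`g(r) = (1 + 2ε² cos θ_{e₀}(r)) / (1 + 2ε²)`. [folklore] -/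
theorem coherence_waveState (hL : 0 < L) (hε : |ε| < 1 / 2) (r : Space) :
    coherence n L (waveState n hL ε) r =
      (1 + 2 * ε ^ 2 * Real.cos (arg L e0 r)) / (1 + 2 * ε ^ 2) := by
  unfold coherence
  simp only [waveState_ψ, norm_waveFun_vecCons hL hε]
  have hinner : ∀ x : Space, ∫ Y in cellN n L,
      (waveFactor L ε (x + r) * ∏ i, waveFactor L ε (Y i)) *
        (waveFactor L ε x * ∏ i, waveFactor L ε (Y i)) =
      waveFactor L ε (x + r) * waveFactor L ε x := by
    intro x
    have : ∀ Y : Config n, (waveFactor L ε (x + r) * ∏ i, waveFactor L ε (Y i)) *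
        (waveFactor L ε x * ∏ i, waveFactor L ε (Y i)) =
        (waveFactor L ε (x + r) * waveFactor L ε x) * ∏ i, waveFactor L ε (Y i) ^ 2 := by
      intro Y; rw [Finset.prod_pow]; ring
    simp_rw [this]
    rw [integral_const_mul, integral_cellN_prod_real (fun _ y => waveFactor L ε y ^ 2)]
    simp [integral_cell_waveFactor_sq hL]
  simp_rw [hinner]
  exact integral_cell_waveFactor_shift_mul hL ε r

/-- `1 + 2ε² cos θ > 0` for `|ε| < 1/2`. [folklore] -/
theorem one_add_cos_pos (hε : |ε| < 1 / 2) (θ : ℝ) : 0 < 1 + 2 * ε ^ 2 * Real.cos θ := by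
  have h1 : ε ^ 2 < 1 / 4 := by
    have := abs_nonneg ε
    calc ε ^ 2 = |ε| ^ 2 := (sq_abs ε).symm
      _ < (1 / 2) ^ 2 := by exact pow_lt_pow_left₀ hε this two_ne_zero
      _ = 1 / 4 := by norm_num
  nlinarith [Real.neg_one_le_cos θ, sq_nonneg ε]

/-- **The Lévy weight of the density wave at the modulation mode is bounded below**:
`ν_{e₀} ≥ ε²(1 − 2ε²)` (exactly `ν_{e₀} = ε² − O(ε⁶)`). [folklore] -/
theorem levyWeight_waveState_ge (hL : 0 < L) (hε : |ε| < 1 / 2) :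
    ε ^ 2 * (1 - 2 * ε ^ 2) ≤ levyWeight n L (waveState n hL ε) e0 := by
  unfold levyWeight
  simp_rw [coherence_waveState hL hε]
  have ht0 : (0 : ℝ) ≤ 2 * ε ^ 2 := by positivity
  have hε2 : ε ^ 2 < 1 / 4 := by
    calc ε ^ 2 = |ε| ^ 2 := (sq_abs ε).symm
      _ < (1 / 2) ^ 2 := pow_lt_pow_left₀ hε (abs_nonneg ε) two_ne_zero
      _ = 1 / 4 := by norm_num
  have ht' : 2 * ε ^ 2 ≤ 1 / 2 := by linarith
  have h1t : (0 : ℝ) < 1 + 2 * ε ^ 2 := by linarith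
  -- the integrand as `cos θ · (log(1 + t cos θ) − log(1 + t))`, `t = 2ε²`
  have hG : ∀ x : Space, Real.log ((1 + 2 * ε ^ 2 * Real.cos (arg L e0 x)) / (1 + 2 * ε ^ 2)) =
      Real.log (1 + 2 * ε ^ 2 * Real.cos (arg L e0 x)) - Real.log (1 + 2 * ε ^ 2) := fun x =>
    Real.log_div (one_add_cos_pos hε _).ne' h1t.ne'
  rw [cellFourierCoeff_eq_integral hL, Complex.smul_re, smul_eq_mul]
  have hcont : Continuous fun x : Space =>
      ((Real.log ((1 + 2 * ε ^ 2 * Real.cos (arg L e0 x)) / (1 + 2 * ε ^ 2)) : ℝ) : ℂ) := by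
    refine Complex.continuous_ofReal.comp (Continuous.log (by fun_prop) fun x => ?_)
    exact (div_pos (one_add_cos_pos hε _) h1t).ne'
  have hint : Integrable (fun x => conj (cellWave L e0 x) *
      ((Real.log ((1 + 2 * ε ^ 2 * Real.cos (arg L e0 x)) / (1 + 2 * ε ^ 2)) : ℝ) : ℂ))
      (volume.restrict (cell L)) :=
    integrableOn_cell ((Complex.continuous_conj.comp (continuous_cellWave L e0)).mul hcont)
  have h2 := integral_re hint
  simp only [RCLike.re_to_complex] at h2
  rw [← h2]
  have ic : Integrable (fun x => Real.cos (arg L e0 x) *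
      Real.log (1 + 2 * ε ^ 2 * Real.cos (arg L e0 x))) (volume.restrict (cell L)) := by
    refine integrableOn_cell (Continuous.mul (by fun_prop) (Continuous.log (by fun_prop) fun x => ?_))
    exact (one_add_cos_pos hε (arg L e0 x)).ne'
  have ik : Integrable (fun x => Real.cos (arg L e0 x) * Real.log (1 + 2 * ε ^ 2))
      (volume.restrict (cell L)) := integrableOn_cell (by fun_prop)
  have hpt : ∀ x : Space, (conj (cellWave L e0 x) *
      ((Real.log ((1 + 2 * ε ^ 2 * Real.cos (arg L e0 x)) / (1 + 2 * ε ^ 2)) : ℝ) : ℂ)).re =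
      Real.cos (arg L e0 x) * Real.log (1 + 2 * ε ^ 2 * Real.cos (arg L e0 x)) -
        Real.cos (arg L e0 x) * Real.log (1 + 2 * ε ^ 2) := by
    intro x
    simp only [Complex.mul_re, Complex.ofReal_re, Complex.ofReal_im, mul_zero, sub_zero,
      Complex.conj_re, re_cellWave, hG]
    ring
  simp_rw [hpt]
  rw [integral_sub ic ik, integral_mul_const, integral_cell_cos_arg hL e0_ne_zero, zero_mul,
    sub_zero]
  -- lower bound by `t(1 − t) cos²`, whose cell integral is `t(1 − t) L³/2`
  have ilow : Integrable (fun x => 2 * ε ^ 2 * (1 - 2 * ε ^ 2) * Real.cos (arg L e0 x) ^ 2)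
      (volume.restrict (cell L)) := integrableOn_cell (by fun_prop)
  have hmono : ∫ x in cell L, 2 * ε ^ 2 * (1 - 2 * ε ^ 2) * Real.cos (arg L e0 x) ^ 2 ≤
      ∫ x in cell L, Real.cos (arg L e0 x) * Real.log (1 + 2 * ε ^ 2 * Real.cos (arg L e0 x)) :=
    integral_mono ilow ic fun x => mul_log_one_add_mul_ge ht0 ht' (Real.abs_cos_le_one _)
  have hval : ∫ x in cell L, 2 * ε ^ 2 * (1 - 2 * ε ^ 2) * Real.cos (arg L e0 x) ^ 2 =
      2 * ε ^ 2 * (1 - 2 * ε ^ 2) * (L ^ 3 / 2) := by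
    have : (fun x => 2 * ε ^ 2 * (1 - 2 * ε ^ 2) * Real.cos (arg L e0 x) ^ 2) = fun x =>
        (2 * ε ^ 2 * (1 - 2 * ε ^ 2) / 2 + 0 * Real.cos (arg L e0 x) +
          (2 * ε ^ 2 * (1 - 2 * ε ^ 2) / 2) * Real.cos (arg L ((2 : ℤ) • e0) x) +
            0 * Real.cos (arg L ((3 : ℤ) • e0) x)) := by
      funext x
      rw [Real.cos_sq, arg_intSMul, show ((2 : ℤ) : ℝ) * arg L e0 x = 2 * arg L e0 x by
        push_cast; ring]
      ring
    rw [this, integral_cell_trig_combo hL e0_ne_zero]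
    ring
  have hL3 : 0 < L ^ 3 := by positivity
  calc ε ^ 2 * (1 - 2 * ε ^ 2) = (L ^ 3)⁻¹ * (2 * ε ^ 2 * (1 - 2 * ε ^ 2) * (L ^ 3 / 2)) := by
        field_simp
    _ ≤ (L ^ 3)⁻¹ * ∫ x in cell L, Real.cos (arg L e0 x) *
          Real.log (1 + 2 * ε ^ 2 * Real.cos (arg L e0 x)) :=
        mul_le_mul_of_nonneg_left (hval.symm.le.trans hmono) (by positivity)

end Wave

end Summit.AtomisticToContinuum.BoseEinsteinCondensation.Theorems.InfraredMinimumUncertainty.Negative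

end
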